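import Summits.Langlands.Langlands.Theses.SenNullAlignment
import HarnessLib

/-!
# Birth skeleton (BC3) for the piece `CorrespondenceRigidityGL2` of the BC2 redirect of
# `SenNullAlignment.SectorComplement` (stmt-Langlands-16308) — line `birth_CorrespondenceRigidityGL2`

The piece is the RIGIDITY of the GL₂ correspondence across Henniart-normalised pinned data and across frames.
It is cut along its three literature seams:
* `stub_recRigidityGL2` (Henniart 1993 Thm 1.1 in the form the summit reads it, rank 2: two PINNED reciprocity data
  have the same `rec₂` on the local components of cuspidal automorphic representations of GL₂ — the `n = 2` case of the
  lever R of the live line `Sketch_18745_r1_k1` on the sibling crux stmt-Langlands-18745, where rank ≤ 1 and the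
  supercuspidal classes are already reduced to the named fact `localLanglands_gl` and the pins; the generic
  non-supercuspidal classes of rank 2 are its held stub S5);
* `stub_correspondsOfIsConjugate` (frame invariance of `Corresponds`, a THEOREM landed as
  `ReciprocityUpToIrreducibility.corresponds_of_isConjugate`, restated as text for cone hygiene);
* `stub_avatarConjugacy` (U, VERBATIM item stmt-Langlands-17844; landed as `isConjugate_of_satakeFrobCompatibleAt`).
`CorrespondenceRigidityGL2_of`: U gives `IsConjugate ρ ρ'`, frame invariance gives `Corresponds Rec ι π ρ'`, and rec-rigidity
transports it to `Rec'` place by place (`ReciprocityData.pst` is `Rec`-free by `rfl`).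

Shape (for `ledger skeleton check`): named stubs `theorem stub_<name> : <Prop> := by sorry` (the ONLY sorries),
`_Goal.stub_<name> : Prop := type_of% @stub_<name>`, and `CorrespondenceRigidityGL2_of (h₁ : _Goal.stub_…) … : CorrespondenceRigidityGL2` concluding
the piece BY NAME (real proof); the last `example` feeds the stubs to it.  PRE-SPLIT VERSION: the piece is not yet a
decl of the route file, so it is declared here, VERBATIM the text filed in children.json, inside the route namespace;
after `route edit --split` lands it, delete section `0` and this file refers to the route decl unchanged.
-/

noncomputable section

set_option linter.dupNamespace false

/-! ## 0. The piece, verbatim (pre-split stand-in for the route decl) -/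

namespace Summit.Langlands.Langlands.Theses.SenNullAlignment

open scoped BigOperators Topology Manifold Classical MeasureTheory ProbabilityTheory Matrix InnerProductSpace ComplexConjugate ContinuousMap
open Filter Set Function TopologicalSpace MeasureTheory

/-- **P3 — rigidity of the GL₂ correspondence across pinned data and frames** (children.json text, verbatim). -/
def CorrespondenceRigidityGL2 : Prop :=
  ∀ (K : Type) [Field K] [NumberField K] (Rec Rec' : Summit.Langlands.ReciprocityData K) (hcpt : Literature.NumberTheory.Automorphic.isCompact_glFiniteIntegralLevel 2 K) (π : Literature.NumberTheory.Automorphic.CuspidalAutomorphicRepData 2 K hcpt) (ℓ : ℕ) [Fact ℓ.Prime] (ι : PadicAlgCl ℓ ≃+* ℂ) (ρ ρ' : Literature.NumberTheory.GaloisRepresentations.FramedGaloisRep K (PadicAlgCl ℓ) 2), ρ.toGaloisRep.IsIrreducible → Summit.Langlands.Corresponds Rec ι π.1 ρ → (∀ᶠ v : IsDedekindDomain.HeightOneSpectrum (NumberField.RingOfIntegers K) in Filter.cofinite, Summit.Langlands.SatakeFrobCompatibleAt ι π.1 ρ' v) → Summit.Langlands.IsConjugate ρ ρ' ∧ Summit.Langlands.Corresponds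 Rec' ι π.1 ρ'

end Summit.Langlands.Langlands.Theses.SenNullAlignment

namespace Summit.Langlands.Langlands.Cruxes.CorrespondenceRigidityGL2.Birth

open scoped MatrixGroups Matrix Classical Polynomial NumberField BigOperators Topology
open Filter IsDedekindDomain
open Literature.NumberTheory.Automorphic Literature.NumberTheory.GaloisRepresentations
open Summit.Langlands
open Summit.Langlands.Langlands.Theses.SenNullAlignment (CorrespondenceRigidityGL2)

/-! ## 1. The stubs (the ONLY sorries of this file) -/

/-- **stub R₂ — rec-rigidity of pinned reciprocity data on the local components of cuspidal `π` of `GL₂`**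
(Henniart 1993 Thm 1.1 / Harris–Taylor Thm A uniqueness, read through the pins `llc_isCanonical`,
`llc_eps_isCanonical`; local components of cuspidal `π` are generic — Shalika).
[cite: Henniarts1993, Thm 1.1] [cite: HarrisTaylorAMS2001, Thm. A] -/
theorem stub_recRigidityGL2 : ∀ (K : Type) [Field K] [NumberField K] (Rec Rec' : Summit.Langlands.ReciprocityData K) (hcpt : Literature.NumberTheory.Automorphic.isCompact_glFiniteIntegralLevel 2 K) (π : Literature.NumberTheory.Automorphic.CuspidalAutomorphicRepData 2 K hcpt) (v : IsDedekindDomain.HeightOneSpectrum (NumberField.RingOfIntegers K)) (πv : Literature.NumberTheory.Automorphic.SmoothIrrep (GL (Fin 2) (v.adicCompletion K))), π.1.HasLocalComponentAt v πv.ρ → (Rec.llc v).recGL 2 (Literature.NumberTheory.Automorphic.IrrClass.mk πv) = (Rec'.llc v).recGL 2 (Literature.NumberTheory.Automorphic.IrrClass.mk πv) := by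
  sorry

/-- **stub C — `Corresponds` descends to conjugacy classes** (frame invariance: Satake clause by similarity of
characteristic polynomials, `v ∤ ℓ` by conjugating the Grothendieck–Deligne Weil–Deligne representation and its complex
transport, `v ∣ ℓ` by the pinned datum's `conj` field; a THEOREM, landed as
`ReciprocityUpToIrreducibility.corresponds_of_isConjugate`). [cite: DeligneAntwerpII1973, §8.4] -/
theorem stub_correspondsOfIsConjugate : ∀ (K : Type) [Field K] [NumberField K] (n : ℕ) (hcpt : Literature.NumberTheory.Automorphic.isCompact_glFiniteIntegralLevel n K) (Rec : Summit.Langlands.ReciprocityData K) (ℓ : ℕ) [Fact ℓ.Prime] (ι : PadicAlgCl ℓ ≃+* ℂ) (π : Literature.NumberTheory.Automorphic.CuspidalAutomorphicRepData n K hcpt) (ρ ρ' : Literature.NumberTheory.GaloisRepresentations.FramedGaloisRep K (PadicAlgCl ℓ) n), Summit.Langlands.Corresponds Rec ι π.1 ρ → Summit.Langlands.IsConjugate ρ ρ' → Summit.Langlands.Corresponds Rec ι π.1 ρ' := by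
  sorry

/-- **stub U — uniqueness of the irreducible Satake avatar up to conjugacy** (VERBATIM item stmt-Langlands-17844).
[cite: DeligneSerreASENS1974, Lemme 3.2] -/
theorem stub_avatarConjugacy : ∀ (K : Type) [Field K] [NumberField K] (n : ℕ) (hcpt : Literature.NumberTheory.Automorphic.isCompact_glFiniteIntegralLevel n K) (π : Literature.NumberTheory.Automorphic.CuspidalAutomorphicRepData n K hcpt) (ℓ : ℕ) [Fact ℓ.Prime] (ι : PadicAlgCl ℓ ≃+* ℂ) (ρ₀ ρ : Literature.NumberTheory.GaloisRepresentations.FramedGaloisRep K (PadicAlgCl ℓ) n), ρ₀.toGaloisRep.IsIrreducible → (∀ᶠ v : IsDedekindDomain.HeightOneSpectrum (NumberField.RingOfIntegers K) in Filter.cofinite, Summit.Langlands.SatakeFrobCompatibleAt ι π.1 ρ₀ v) → (∀ᶠ v : IsDedekindDomain.HeightOneSpectrum (NumberField.RingOfIntegers K) in Filter.cofinite, Summit.Langlands.SatakeFrobCompatibleAt ι π.1 ρ v) → Summit.Langlands.IsConjugate ρ₀ ρ := by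
  sorry

/-! ## 2. The stub statements as named propositions -/

namespace _Goal

/-- The statement of `stub_recRigidityGL2` (literally its type). [folklore] -/
def stub_recRigidityGL2 : Prop :=
  type_of% @Summit.Langlands.Langlands.Cruxes.CorrespondenceRigidityGL2.Birth.stub_recRigidityGL2

/-- The statement of `stub_correspondsOfIsConjugate` (literally its type). [folklore] -/
def stub_correspondsOfIsConjugate : Prop :=
  type_of% @Summit.Langlands.Langlands.Cruxes.CorrespondenceRigidityGL2.Birth.stub_correspondsOfIsConjugate

/-- The statement of `stub_avatarConjugacy` (literally its type). [folklore] -/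
def stub_avatarConjugacy : Prop :=
  type_of% @Summit.Langlands.Langlands.Cruxes.CorrespondenceRigidityGL2.Birth.stub_avatarConjugacy

end _Goal

/-! ## 3. The composition (kernel-checked, no `sorry`) -/

/-- **`CorrespondenceRigidityGL2` from its three stubs**: U, then frame invariance, then transport of
local–global compatibility along rec-rigidity place by place (`ReciprocityData.pst` ignores its datum). -/
theorem CorrespondenceRigidityGL2_of (hRig : _Goal.stub_recRigidityGL2) (hConj : _Goal.stub_correspondsOfIsConjugate)
    (hU : _Goal.stub_avatarConjugacy) : CorrespondenceRigidityGL2 := by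
  dsimp only [_Goal.stub_recRigidityGL2, _Goal.stub_correspondsOfIsConjugate, _Goal.stub_avatarConjugacy] at hRig hConj hU
  intro K _ _ Rec Rec' hcpt π ℓ _ ι ρ ρ' hirr hcorr hsat'
  have hc : Summit.Langlands.IsConjugate ρ ρ' := hU K 2 hcpt π ℓ ι ρ ρ' hirr hcorr.1 hsat'
  have h' : Summit.Langlands.Corresponds Rec ι π.1 ρ' := hConj K 2 hcpt Rec ℓ ι π ρ ρ' hcorr hc
  refine ⟨hc, h'.1, fun v => ?_⟩
  obtain ⟨πv, r, rℂ, hπv, hlad, hpst, htr, hcls⟩ := h'.2 v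
  refine ⟨πv, r, rℂ, hπv, hlad, hpst, htr, ?_⟩
  rw [← hRig K Rec Rec' hcpt π v πv hπv]
  exact hcls

/-- By-name sanity check: the stubs feed the composition as they stand. -/
example : CorrespondenceRigidityGL2 :=
  CorrespondenceRigidityGL2_of stub_recRigidityGL2 stub_correspondsOfIsConjugate stub_avatarConjugacy

end Summit.Langlands.Langlands.Cruxes.CorrespondenceRigidityGL2.Birth

end
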